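import Summits.QuantumFields.GaugeBoot.StrongCouplingSU3Traces
import Summits.QuantumFields.GaugeBoot.StrongCouplingPlaquetteSUNPieces
import HarnessLib

/-!
# Strong coupling from the loop equation: the cubic moments of the `SU(3)` plaquette, `E[(tr U_P)³] = 1 + O(β)` (gauge-boot, ADDENDUM 24 part F)

HONEST FRAMING (cell `pub-gaugeboot`, page 1 of every file): the venture produces certified bounds
on lattice expectations at stated coupling, gauge group, dimension and torus size; NOT a mass gap,
NOT a continuum limit, NOT a string tension; NOT Yang–Mills-summit-bearing (barriers
`FixedCouplingUltralocality`, `PerturbativeInvisibility`).  Exact identities and crude explicit `O(β)` bounds on a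
finite torus `(ℤ/L)^d`, `L ≥ 2`, every real `β` (tree coupling `β = β_std/3`); no number of the cell's tables is
certified here.

## Content

The second strong-coupling coefficient of the `SU(3)` plaquette (`β_std²/216`, ADDENDUM 24) is the Haar "baryon"
moment `∫_{SU(3)} (tr U)³ dU = 1`.  The loop equations see it through the doubly-wound plaquette `P̃₀·P̃₀` with the
plaquette `P̃₀` (or `P̃₀⁻¹`) as SPECTATOR, closed by the `SU(3)` Cayley–Hamilton identities of
`StrongCouplingSU3Traces` (`tr U_P² = (tr U_P)² − 2 tr U_P⁻¹`, `tr U_P³ = (tr U_P)³ − 3 tr U_P tr U_P⁻¹ + 3`):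

* `doublyWound_spectator_identity_suN` — ★ `(N − 3/N)·E[tr U_P² · tr U_P] + E[(tr U_P)³] + E[tr U_P³] = −(β/2)ΣΣ E[plaqTerm(P̃₀P̃₀)·tr U_P]`
  (`SU(N)`, every `N`);
* ★★★ `norm_integral_trace_cube_sub_one_su3_le` — **`SU(3)`: `‖E[(tr U_P)³] − 1‖ ≤ 30(d−1)|β|`** for every `L ≥ 2` and
  every real `β`: the baryon vertex at strong coupling as a theorem (from `4κ − 7m + 3 = O(β)`, `m = E|tr U_P|² = 1 + O(β)`).
The companion file `StrongCouplingCubicSU3Reverse` treats the spectator `P̃₀⁻¹` (`E[tr U_P² tr U_P⁻¹]`, `E[(tr U_P)² tr U_P⁻¹] = O(β)`).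

References: Yu. Makeenko, *Methods of contemporary gauge theory* (2002) Problem 12.7; M. Creutz, *Quarks, gluons and
lattices* (1983) Ch. 8 (`SU(3)` one-link integrals, baryon vertex); S. Mandelstam, Phys. Rev. D 19 (1979) 2391.
Everything is `[folklore]`.
-/

noncomputable section

open MeasureTheory Filter Topology NormedSpace
open scoped Matrix.Norms.Frobenius Matrix ComplexConjugate
open Literature.MathematicalPhysics.QuantumFieldTheory Literature.MathematicalPhysics.QuantumLattice
open Summit.QuantumFields.YangMills.Cruxes.CurvatureAmnesia.WardDefect.SchwingerDyson

namespace Summit.QuantumFields.GaugeBoot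

namespace StrongCoupling

variable {d L N : ℕ} {G : Type} [Group G] {ρ : G →* Matrix (Fin N) (Fin N) ℂ}

/-! ## The doubly-wound plaquette with a spectator: two identities (`SU(N)`) -/

section Identities

variable [NeZero L]

/-- ★ **Doubly-wound plaquette, spectator `P̃₀`** (`SU(N)`, every `L ≥ 2`, every real `β`): with `y = E[tr hol(P̃₀P̃₀)·tr hol P̃₀]`,
`κ = E[(tr hol P̃₀)³]`, `z = E[tr(hol(P̃₀P̃₀)·hol P̃₀)]`:
`(N − 3/N)·y + κ + z = −(β/2)ΣΣ E[plaqTerm(P̃₀P̃₀)·tr hol P̃₀]`. [folklore] -/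
theorem doublyWound_spectator_identity_suN (hL : (1 : ZMod L) ≠ 0) (β : ℝ) (x : Site d L) {μ ν₀ : Fin d} (hμν₀ : μ ≠ ν₀) :
    ((N : ℂ) - 3 / N) * (∫ U, (fundamentalRep (Fin N) (wordHolonomy U x (plaqWord μ ν₀ true ++ plaqWord μ ν₀ true))).trace *
        (fundamentalRep (Fin N) (wordHolonomy U x (plaqWord μ ν₀ true))).trace
          ∂(wilsonMeasure (d := d) (L := L) (fundamentalRep (Fin N)) β)) +
      (∫ U, (fundamentalRep (Fin N) (wordHolonomy U x (plaqWord μ ν₀ true))).trace *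
        (fundamentalRep (Fin N) (wordHolonomy U x (plaqWord μ ν₀ true))).trace *
        (fundamentalRep (Fin N) (wordHolonomy U x (plaqWord μ ν₀ true))).trace
          ∂(wilsonMeasure (d := d) (L := L) (fundamentalRep (Fin N)) β)) +
      (∫ U, (fundamentalRep (Fin N) (wordHolonomy U x (plaqWord μ ν₀ true ++ plaqWord μ ν₀ true)) *
          fundamentalRep (Fin N) (wordHolonomy U x (plaqWord μ ν₀ true))).trace
          ∂(wilsonMeasure (d := d) (L := L) (fundamentalRep (Fin N)) β)) =
      -((β / 2 : ℂ) * ∑ ν ∈ Finset.univ.erase μ, ∑ ε : Bool,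
        ∫ U, plaqTerm (fundamentalRep (Fin N)) 1 x μ U (plaqWord μ ν₀ true ++ plaqWord μ ν₀ true) ν ε *
          (fundamentalRep (Fin N) (wordHolonomy U x (plaqWord μ ν₀ true))).trace
            ∂(wilsonMeasure (d := d) (L := L) (fundamentalRep (Fin N)) β)) := by
  have hcl : Word.endpoint x (plaqWord μ ν₀ true ++ plaqWord μ ν₀ true) = x := by
    rw [Word.endpoint_append, endpoint_plaqWord, endpoint_plaqWord]
  have h := loopEquation₂_specialUnitaryGroup (d := d) (L := L) N β x μ (plaqWord μ ν₀ true ++ plaqWord μ ν₀ true) hcl x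
    (plaqWord μ ν₀ true)
  have hi1 : ∀ k, Integrable (fun U : GaugeConfig d L (Matrix.specialUnitaryGroup (Fin N) ℂ) =>
      splitTerm (fundamentalRep (Fin N)) 1 x μ U (plaqWord μ ν₀ true ++ plaqWord μ ν₀ true) k *
        (fundamentalRep (Fin N) (wordHolonomy U x (plaqWord μ ν₀ true))).trace)
      (wilsonMeasure (d := d) (L := L) (fundamentalRep (Fin N)) β) :=
    fun k => integrable_of_continuous (fundamentalLatticeRep N) β
      ((continuous_splitTerm (fundamentalLatticeRep N) 1 x μ _ k).mul (continuous_trace_wordHolonomy (fundamentalLatticeRep N) x _))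
  have hi2 : ∀ k, Integrable (fun U : GaugeConfig d L (Matrix.specialUnitaryGroup (Fin N) ℂ) =>
      mergeTerm (fundamentalRep (Fin N)) 1 x μ U (plaqWord μ ν₀ true ++ plaqWord μ ν₀ true) x (plaqWord μ ν₀ true) k)
      (wilsonMeasure (d := d) (L := L) (fundamentalRep (Fin N)) β) :=
    fun k => integrable_of_continuous (fundamentalLatticeRep N) β (continuous_mergeTerm (fundamentalLatticeRep N) 1 x μ _ x _ k)
  rw [← integral_finsetSum _ fun k _ => hi1 k, ← integral_finsetSum _ fun k _ => hi2 k] at h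
  simp_rw [← Finset.sum_mul, sum_splitTerm_double (fundamentalRep (Fin N)) hL 1 x hμν₀,
    sum_mergeTerm_spectator_plaqWord (fundamentalRep (Fin N)) hL 1 x hμν₀] at h
  -- integrability of the pieces
  have hc : ∀ u : Word d, Continuous fun U : GaugeConfig d L (Matrix.specialUnitaryGroup (Fin N) ℂ) =>
      (fundamentalRep (Fin N) (wordHolonomy U x u)).trace := fun u => continuous_trace_wordHolonomy (fundamentalLatticeRep N) x u
  have hiY : Integrable (fun U : GaugeConfig d L (Matrix.specialUnitaryGroup (Fin N) ℂ) =>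
      (fundamentalRep (Fin N) (wordHolonomy U x (plaqWord μ ν₀ true ++ plaqWord μ ν₀ true))).trace *
        (fundamentalRep (Fin N) (wordHolonomy U x (plaqWord μ ν₀ true))).trace)
      (wilsonMeasure (d := d) (L := L) (fundamentalRep (Fin N)) β) :=
    integrable_of_continuous (fundamentalLatticeRep N) β ((hc _).mul (hc _))
  have hiK : Integrable (fun U : GaugeConfig d L (Matrix.specialUnitaryGroup (Fin N) ℂ) =>
      (fundamentalRep (Fin N) (wordHolonomy U x (plaqWord μ ν₀ true))).trace *
        (fundamentalRep (Fin N) (wordHolonomy U x (plaqWord μ ν₀ true))).trace *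
        (fundamentalRep (Fin N) (wordHolonomy U x (plaqWord μ ν₀ true))).trace)
      (wilsonMeasure (d := d) (L := L) (fundamentalRep (Fin N)) β) :=
    integrable_of_continuous (fundamentalLatticeRep N) β (((hc _).mul (hc _)).mul (hc _))
  have hiZ : Integrable (fun U : GaugeConfig d L (Matrix.specialUnitaryGroup (Fin N) ℂ) =>
      (fundamentalRep (Fin N) (wordHolonomy U x (plaqWord μ ν₀ true ++ plaqWord μ ν₀ true)) *
        fundamentalRep (Fin N) (wordHolonomy U x (plaqWord μ ν₀ true))).trace)
      (wilsonMeasure (d := d) (L := L) (fundamentalRep (Fin N)) β) :=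
    integrable_of_continuous (fundamentalLatticeRep N) β
      (((continuous_fundamentalRep (Fin N)).comp (continuous_wordHolonomy x _)).mul
        ((continuous_fundamentalRep (Fin N)).comp (continuous_wordHolonomy x _))).matrix_trace
  have e1 : ∀ U : GaugeConfig d L (Matrix.specialUnitaryGroup (Fin N) ℂ),
      (((N : ℂ) - 1 / N) * (fundamentalRep (Fin N) (wordHolonomy U x (plaqWord μ ν₀ true ++ plaqWord μ ν₀ true))).trace +
        ((fundamentalRep (Fin N) (wordHolonomy U x (plaqWord μ ν₀ true))).trace *
            (fundamentalRep (Fin N) (wordHolonomy U x (plaqWord μ ν₀ true))).trace -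
          1 / N * (fundamentalRep (Fin N) (wordHolonomy U x (plaqWord μ ν₀ true ++ plaqWord μ ν₀ true))).trace)) *
        (fundamentalRep (Fin N) (wordHolonomy U x (plaqWord μ ν₀ true))).trace =
      ((N : ℂ) - 2 / N) * ((fundamentalRep (Fin N) (wordHolonomy U x (plaqWord μ ν₀ true ++ plaqWord μ ν₀ true))).trace *
          (fundamentalRep (Fin N) (wordHolonomy U x (plaqWord μ ν₀ true))).trace) +
        (fundamentalRep (Fin N) (wordHolonomy U x (plaqWord μ ν₀ true))).trace *
          (fundamentalRep (Fin N) (wordHolonomy U x (plaqWord μ ν₀ true))).trace *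
          (fundamentalRep (Fin N) (wordHolonomy U x (plaqWord μ ν₀ true))).trace := fun U => by ring
  simp_rw [e1] at h
  rw [integral_add (hiY.const_mul _) hiK, integral_const_mul, integral_sub hiZ (hiY.const_mul _), integral_const_mul] at h
  linear_combination h

end Identities

/-! ## `SU(3)`: the cubic moments through Cayley–Hamilton -/

section SU3

variable [NeZero L]

omit [NeZero L] in
/-- `tr ρ(hol_x X⁻¹) = conj tr ρ(hol_x X)` for a closed word in lattice `SU(N)` (`g⁻¹ = g†`). [folklore] -/
theorem trace_wordHolonomy_reverse_eq_conj {N : ℕ} (U : GaugeConfig d L (Matrix.specialUnitaryGroup (Fin N) ℂ)) (x : Site d L)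
    (X : Word d) (hX : Word.endpoint x X = x) :
    (fundamentalRep (Fin N) (wordHolonomy U x X.reverse)).trace = conj (fundamentalRep (Fin N) (wordHolonomy U x X)).trace := by
  have hrev : wordHolonomy U x X.reverse = (wordHolonomy U x X)⁻¹ := by
    have h := wordHolonomy_reverse U x X; rwa [hX] at h
  rw [hrev, fundamentalRep_apply, fundamentalRep_apply, ← Matrix.star_eq_inv, Matrix.specialUnitaryGroup.coe_star,
    Matrix.star_eq_conjTranspose, Matrix.trace_conjTranspose, Complex.star_def]

/-- ★★★ **THE BARYON VERTEX AT STRONG COUPLING, `SU(3)`**: on every torus `(ℤ/L)^d`, `L ≥ 2`, `d ≥ 2`, and for every real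
(tree) coupling `β`: `‖E[(tr U_P)³] − 1‖ ≤ 30(d−1)|β|` — the Haar moment `∫_{SU(3)}(tr U)³ = 1` of the baryon vertex
emerges from the loop equations (`4κ − 7m + 3 = O(β)` by `doublyWound_spectator_identity_suN` and Cayley–Hamilton,
`m = E|tr U_P|² = 1 + O(β)` by the reverse-spectator identity). [folklore] -/
theorem norm_integral_trace_cube_sub_one_su3_le (hL : (1 : ZMod L) ≠ 0) (β : ℝ) (x : Site d L) {μ ν₀ : Fin d}
    (hμν₀ : μ ≠ ν₀) :
    ‖(∫ U, (fundamentalRep (Fin 3) (wordHolonomy U x (plaqWord μ ν₀ true))).trace *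
        (fundamentalRep (Fin 3) (wordHolonomy U x (plaqWord μ ν₀ true))).trace *
        (fundamentalRep (Fin 3) (wordHolonomy U x (plaqWord μ ν₀ true))).trace
          ∂(wilsonMeasure (d := d) (L := L) (fundamentalRep (Fin 3)) β)) - 1‖ ≤ 30 * ((d : ℝ) - 1) * |β| := by
  haveI := isProbabilityMeasure_wilsonMeasure (d := d) (L := L) (fundamentalRep (Fin 3)) (continuous_fundamentalRep (Fin 3)) β
  have hP : Word.endpoint x (plaqWord μ ν₀ true) = x := endpoint_plaqWord x μ ν₀ true
  set t : GaugeConfig d L (Matrix.specialUnitaryGroup (Fin 3) ℂ) → ℂ :=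
    fun U => (fundamentalRep (Fin 3) (wordHolonomy U x (plaqWord μ ν₀ true))).trace with ht
  set t' : GaugeConfig d L (Matrix.specialUnitaryGroup (Fin 3) ℂ) → ℂ :=
    fun U => (fundamentalRep (Fin 3) (wordHolonomy U x (plaqWord μ ν₀ true).reverse)).trace with ht'
  -- the identity `2y + κ + z = R₄`
  have hI := doublyWound_spectator_identity_suN (d := d) (L := L) (N := 3) hL β x hμν₀
  have hR4 := norm_sum_sum_integral_plaqTerm_mul_trace_le (d := d) (L := L) (fundamentalLatticeRep 3) β 1 x μ
    (plaqWord μ ν₀ true ++ plaqWord μ ν₀ true) x (plaqWord μ ν₀ true)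
  rw [norm_one, show ((fundamentalLatticeRep 3).N : ℝ) = 3 from rfl] at hR4
  have hc : ∀ u : Word d, Continuous fun U : GaugeConfig d L (Matrix.specialUnitaryGroup (Fin 3) ℂ) =>
      (fundamentalRep (Fin 3) (wordHolonomy U x u)).trace := fun u => continuous_trace_wordHolonomy (fundamentalLatticeRep 3) x u
  -- Cayley–Hamilton: `tr(P²)·t = t³ − 2 t·t'` and `tr(ρ(P²)ρ(P)) = t³ − 3 t·t' + 3`
  have hNewton : ∀ U : GaugeConfig d L (Matrix.specialUnitaryGroup (Fin 3) ℂ),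
      (fundamentalRep (Fin 3) (wordHolonomy U x (plaqWord μ ν₀ true ++ plaqWord μ ν₀ true))).trace * t U =
        t U * t U * t U - 2 * (t U * t' U) := fun U => by
    rw [su3_trace_append_self U x _ hP, ht, ht']; ring
  have hCH : ∀ U : GaugeConfig d L (Matrix.specialUnitaryGroup (Fin 3) ℂ),
      (fundamentalRep (Fin 3) (wordHolonomy U x (plaqWord μ ν₀ true ++ plaqWord μ ν₀ true)) *
          fundamentalRep (Fin 3) (wordHolonomy U x (plaqWord μ ν₀ true))).trace =
        t U * t U * t U - 3 * (t U * t' U) + 3 := fun U => by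
    rw [su3_trace_append_self_mul U x _ hP, ht, ht']
  have hiK : Integrable (fun U => t U * t U * t U) (wilsonMeasure (d := d) (L := L) (fundamentalRep (Fin 3)) β) :=
    integrable_of_continuous (fundamentalLatticeRep 3) β (((hc _).mul (hc _)).mul (hc _))
  have hiM : Integrable (fun U => t U * t' U) (wilsonMeasure (d := d) (L := L) (fundamentalRep (Fin 3)) β) :=
    integrable_of_continuous (fundamentalLatticeRep 3) β ((hc _).mul (hc _))
  have hiKM : Integrable (fun U => t U * t U * t U - 3 * (t U * t' U)) (wilsonMeasure (d := d) (L := L) (fundamentalRep (Fin 3)) β) :=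
    hiK.sub (hiM.const_mul _)
  have hy : ∫ U, (fundamentalRep (Fin 3) (wordHolonomy U x (plaqWord μ ν₀ true ++ plaqWord μ ν₀ true))).trace * t U
      ∂(wilsonMeasure (d := d) (L := L) (fundamentalRep (Fin 3)) β) =
      (∫ U, t U * t U * t U ∂(wilsonMeasure (d := d) (L := L) (fundamentalRep (Fin 3)) β)) -
        2 * ∫ U, t U * t' U ∂(wilsonMeasure (d := d) (L := L) (fundamentalRep (Fin 3)) β) := by
    simp_rw [hNewton]
    rw [integral_sub hiK (hiM.const_mul _), integral_const_mul]
  have hz : ∫ U, (fundamentalRep (Fin 3) (wordHolonomy U x (plaqWord μ ν₀ true ++ plaqWord μ ν₀ true)) *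
      fundamentalRep (Fin 3) (wordHolonomy U x (plaqWord μ ν₀ true))).trace
        ∂(wilsonMeasure (d := d) (L := L) (fundamentalRep (Fin 3)) β) =
      (∫ U, t U * t U * t U ∂(wilsonMeasure (d := d) (L := L) (fundamentalRep (Fin 3)) β)) -
        3 * (∫ U, t U * t' U ∂(wilsonMeasure (d := d) (L := L) (fundamentalRep (Fin 3)) β)) + 3 := by
    simp_rw [hCH]
    rw [integral_add hiKM (integrable_const _), integral_sub hiK (hiM.const_mul _), integral_const_mul, integral_const,
      probReal_univ, one_smul]
  -- `m = 1 + O(β)`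
  have hm := norm_integral_trace_mul_trace_reverse_sub_one_suN_le (d := d) (L := L) (N := 3) (by norm_num) hL β x hμν₀
  -- assemble: `4(κ − 1) = 7(m − 1) + R₄`
  have key : 4 * ((∫ U, t U * t U * t U ∂(wilsonMeasure (d := d) (L := L) (fundamentalRep (Fin 3)) β)) - 1) =
      7 * ((∫ U, t U * t' U ∂(wilsonMeasure (d := d) (L := L) (fundamentalRep (Fin 3)) β)) - 1) +
      -((β / 2 : ℂ) * ∑ ν ∈ Finset.univ.erase μ, ∑ ε : Bool,
        ∫ U, plaqTerm (fundamentalRep (Fin 3)) 1 x μ U (plaqWord μ ν₀ true ++ plaqWord μ ν₀ true) ν ε * t U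
          ∂(wilsonMeasure (d := d) (L := L) (fundamentalRep (Fin 3)) β)) := by
    rw [← hI, hy, hz]
    have hN : ((3 : ℕ) : ℂ) = 3 := by norm_num
    rw [hN]
    ring
  have hn := congrArg (fun z : ℂ => ‖z‖) key
  simp only [norm_mul, Complex.norm_ofNat] at hn
  have hβ2 : ‖(β / 2 : ℂ)‖ = |β| / 2 := norm_half_ofReal β
  have hR4' := mul_le_mul_of_nonneg_left hR4 (by positivity : (0 : ℝ) ≤ |β| / 2)
  have hbound : 4 * ‖(∫ U, t U * t U * t U ∂(wilsonMeasure (d := d) (L := L) (fundamentalRep (Fin 3)) β)) - 1‖ ≤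
      7 * (4 * ((d : ℝ) - 1) * 3 * |β|) + |β| / 2 * (((d : ℝ) - 1) * (2 * (2 * 3 * (1 + 1) * 3))) := by
    rw [hn]
    refine (norm_add_le _ _).trans (add_le_add ?_ ?_)
    · rw [norm_mul, Complex.norm_ofNat]; exact mul_le_mul_of_nonneg_left hm (by norm_num)
    · rw [norm_neg, norm_mul, hβ2]; exact hR4'
  linarith

end SU3

end StrongCoupling

end Summit.QuantumFields.GaugeBoot

end
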